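import Summits.HodgeConjecture.HodgeConjecture.Theorems.F0P3cStCharTSShellsTT             -- part 1 (this seat): `shellsTT_of_datum` (the per-shell tuple at a datum); brings the (SHF′) chain ★ SurjOmega, ★ DomBridge ∕ DomGeneral
import Summits.HodgeConjecture.HodgeConjecture.Theorems.F0P3cStCharTSK0WeylG             -- ★ p850013 (A-p16 ∕ LH5-p05) «K0-WEYL-G»: `exists_weylElt_mem_and_forall_mul_mul_inv_mem_three`
import Summits.HodgeConjecture.HodgeConjecture.Theorems.F0P3cStCharTSHKSpellings         -- ★ (LH6-p02 g2) «HK-SPELLINGS»: `valued_sub_one_apply_eq`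
import Summits.HodgeConjecture.HodgeConjecture.Theorems.F0P3cStCharTSShellKit            -- ★ p848983 (LH6-p02): `cm_torus_eq_central_mul_ray_mul_ray_inv` (a ray element `a`, `E₃ a = d(α, 1, (σα)⁻¹)`, `0 < |α|_w < 1`)
import HarnessLib

/-!
# F0 · P3c · line LH6 «StCharTS» — «SHELLS-TT★» (part 2 of 2): the per-shell tuple AT THE T1 LEVELS (the integrator's letter `exists_levels_shellsTT`) and the (SHF′°)
# conjunct of (TOR‴) CLOSED (`shf_core`) [Rogawski1990, §12.7 L. 12.7.1 (proof) p. 191; L. 12.7.2 (proof) pp. 193–194]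

Cell `pub/hodgecm-mathlib`, crux H413 = `stmt-HodgeConjecture-24833` (`--supports`, helper lane), route HCCMUnconditional; seat LH6-p05 (g3); consumer LH6-p01 (g3)
(`weylIntegration_core_of_shells`, (W-D) `…SaHeadTorus5`).  THEOREMS ONLY, sorry-free, ★-only imports, no definition ∕ instance ∕ notation ∕ named fact.

THE MATHEMATICS.  The concrete Iwahori datum of ★ `exists_cmIwahoriDatum_levels` along a ray element `a` (`E₃ a = d(α, 1, (σα)⁻¹)`, `0 < |α|_w < 1`, ★
`cm_torus_eq_central_mul_ray_mul_ray_inv`) has levels `K_n = E₃⁻¹(U′ ∩ K_{|α|^{n+1}})`: in `K_v` (★ `level_le_cmLocalIntegralLevel`), deep at `w` (§1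
`valued_sub_one_le_of_levels`), decreasing (`levelFamily_antitone`), normalised by a long Weyl element `w₀ ∈ K₀` (★ K0-WEYL-G), dominated by every dominant chart point (★
«DOM-BRIDGE» `dominant_torusChart_of_levels`) — `exists_datum`.  Hence (§3):
* **`exists_levels_shellsTT`** — the (TOR)-road integrator's binders `Mlev hMo hMa hMb hM0 hMr hSH` of `weylIntegration_core_of_shells` AS ONE ∃-PACKAGE at
  `M_n := ι⁻¹(M_T ∩ K_n)`: open (★ `isOpen_levelFamily`), decreasing, a basis of `𝓝 1` (★ `exists_levelFamily_subset`), `M_0 ⊆ M_c` (★ `levelFamily_le_torusCompactPart`),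
  `ω`-stable (★ `torusChart_reflect` + `w₀`), and «SHELLS-TT» with the mass read as `(∫ φ dν)·‖u₁‖ = 2κ·μM(u M_n)` (`δ_B^{1∕2}(ι u) = ‖u₁‖`, ★ `rootDeltaChar_cmBorel_torus`);
* **`shf_core`** — the (SHF′°) conjunct of the (TOR‴) package of ★ `F0P3cStCharTSSaHeadTorus4.stSupportFiniteSqInt_of_carpet_torus₄` (text VERBATIM) for EVERY Haar `μM`
  on `M`: ★ `shf_torusTransform_of_levelShells_on … Ω°_w …` (LH6-p05 g2) with its `hshell` binder discharged by part 1 — the per-`(n, u)` Ψ-producer instance that was the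
  (SHF′) residue.  One socket of the leaf's `stub_EllipticPackage` is a theorem.
HONEST LABEL: count-neutral until a leaf edition drops the conjunct; HC_CM is proved only modulo the 7 printed citations (2 remaining: hLiu418 = stmt-HodgeConjecture-24832,
h413 = stmt-HodgeConjecture-24833) until rung 0 closes.

## References
* [Rogawski1990] J. D. Rogawski, *Automorphic Representations of Unitary Groups in Three Variables*, Ann. of Math. Stud. 123 (1990): §12.7 L. 12.7.1 (proof) p. 191,
  L. 12.7.2 (proof) pp. 193–194; §12.2 p. 173.
* [Casselman1995] W. Casselman, *Introduction to the theory of admissible representations of p-adic reductive groups* (1995 notes): Prop. 1.4.4 p. 14, §1.5 Lemma 1.5.1,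
  Thm. 4.4.6 p. 45.
-/

set_option autoImplicit false
-- the mandated namespace has the single-problem summit's repeated segment (`HodgeConjecture.HodgeConjecture`)
set_option linter.dupNamespace false

noncomputable section

open NumberField IsDedekindDomain MeasureTheory Measure Topology Filter
open scoped NNReal ENNReal Pointwise MatrixGroups
open ValuativeRel
open Literature.NumberTheory Literature.NumberTheory.Rogawski1990 Literature.NumberTheory.Automorphic Literature.NumberTheory.Automorphic.UnitaryGroup
open Summit.HodgeConjecture.HodgeConjecture.Cruxes.H413 Summit.HodgeConjecture.HodgeConjecture.Cruxes.H413.F0P3cStCharTSTorusDefs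

namespace Summit.HodgeConjecture.HodgeConjecture.Cruxes.H413.F0P3cStCharTSShellsTTLevels

variable (L : Type) [Field L] [NumberField L] [IsCMField L] (v : HeightOneSpectrum (𝓞 ↥(maximalRealSubfield L)))
  (w : PlacesOver L v) (hw : IsCMField.complexConj L • w.1 = w.1)

/-! ## §1 The levels of the concrete datum are deep at `w` -/

/-- **`|(k_ij − δ_ij)_w| ≤ |α|_w^{n+1}` on `K_n = E₃⁻¹(U′ ∩ K_{|α|^{n+1}})`** (the levels clause of ★ `exists_cmIwahoriDatum_levels`): membership in the principal congruence
subgroup (★ `mem_congruenceGL_iff`), the dictionary ★ `v_le_iff_valuation_le`, and the entrywise reading ★ `valued_sub_one_apply_eq`. [cite: Casselman1995, Prop. 1.4.4 p. 14] -/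
theorem valued_sub_one_le_of_levels (𝓘 : (cmBorelTriple L 3 v).IwahoriDatum) {α : w.1.adicCompletion L}
    (hK : ∀ n, 𝓘.K n = ((congruenceGL 3 (valuation (w.1.adicCompletion L) α ^ (n + 1))).comap (unitaryGroupOfForm (galAdicCompletionMap (L := L) (IsCMField.complexConj L) hw) (placeForm (Rogawski1990.qsForm L) w.1)).subtype).comap
        ((localNonsplitEquiv (IsCMField.complexConj L) (Rogawski1990.qsForm L) (IsCMField.complexConj_ne_one L) w hw) : ↥(«local» L (IsCMField.complexConj L) 3 (Rogawski1990.qsForm L) v) →* ↥(unitaryGroupOfForm (galAdicCompletionMap (L := L) (IsCMField.complexConj L) hw) (placeForm (Rogawski1990.qsForm L) w.1))))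
    (n : ℕ) :
    ∀ k ∈ 𝓘.K n, ∀ i j : Fin 3,
      Valued.v ((((k : GL (Fin 3) (LocalRing L v)).val i j - (1 : Matrix (Fin 3) (Fin 3) (LocalRing L v)) i j) : LocalRing L v) w) ≤ Valued.v α ^ (n + 1) := by
  intro k hk i j
  rw [hK n] at hk
  have hmem := (mem_congruenceGL_iff.1 (Subgroup.mem_comap.1 (Subgroup.mem_comap.1 hk))).2.1 i j
  rw [Matrix.sub_apply, ← map_pow, ← v_le_iff_valuation_le, map_pow] at hmem
  rw [F0P3cStCharTSHKSpellings.valued_sub_one_apply_eq L v w hw]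
  exact hmem


/-! ## §2 The level family is decreasing -/

/-- **THE LEVEL FAMILY `M_n = ι⁻¹(M_T ∩ K_n)` IS DECREASING** for the concrete levels `K_n = E₃⁻¹(U′ ∩ K_{|α|^{n+1}})` (`|α|_w < 1`: the congruence radii decrease,
★ `congruenceGL_mono`). [cite: Casselman1995, Prop. 1.4.4 p. 14] -/
theorem levelFamily_antitone (𝓘 : (cmBorelTriple L 3 v).IwahoriDatum) {α : w.1.adicCompletion L} (hα1 : Valued.v α < 1)
    (hK : ∀ n, 𝓘.K n = ((congruenceGL 3 (valuation (w.1.adicCompletion L) α ^ (n + 1))).comap (unitaryGroupOfForm (galAdicCompletionMap (L := L) (IsCMField.complexConj L) hw) (placeForm (Rogawski1990.qsForm L) w.1)).subtype).comap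
        ((localNonsplitEquiv (IsCMField.complexConj L) (Rogawski1990.qsForm L) (IsCMField.complexConj_ne_one L) w hw) : ↥(«local» L (IsCMField.complexConj L) 3 (Rogawski1990.qsForm L) v) →* ↥(unitaryGroupOfForm (galAdicCompletionMap (L := L) (IsCMField.complexConj L) hw) (placeForm (Rogawski1990.qsForm L) w.1)))) :
    Antitone (fun n => (((𝓘.K n).subgroupOf (cmBorelTriple L 3 v).M).comap (torusChartHom L v) :
      Subgroup ((UnitaryGroup.LocalRing L v)ˣ × ↥(normOneUnits (conjLocal L (IsCMField.complexConj L) v))))) := by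
  have hα1' : valuation (w.1.adicCompletion L) α ≤ 1 := le_of_lt ((v_lt_one_iff_valuation_lt_one α).1 hα1)
  refine antitone_nat_of_succ_le fun n m hm => ?_
  rw [F0P3cStCharTSLevelFamily.mem_levelFamily_iff] at hm ⊢
  have hle : 𝓘.K (n + 1) ≤ 𝓘.K n := by
    rw [hK (n + 1), hK n]
    exact Subgroup.comap_mono (Subgroup.comap_mono (congruenceGL_mono (pow_le_pow_right_of_le_one' hα1' (Nat.le_succ _))))
  exact hle hm

/-! ## §3 The concrete datum and the closed forms: «SHELLS-TT» at the T1 levels, and (SHF′°) CLOSED -/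

include hw in
set_option maxHeartbeats 1600000 in  -- ★ `exists_cmIwahoriDatum_levels`' sixteen-component package (long defeq unfoldings of the one-place model, as there)
/-- **THE CONCRETE DATUM.**  At a non-split `v` there are an Iwahori datum `𝓘` of the Borel triple of `U(Φ₃)(L⁺_v)` and a long Weyl element `w₀` (matrix `Φ₃`) with:
levels in `K_v` (★ `level_le_cmLocalIntegralLevel`), deep at `w` (§1), normalised by `w₀` (★ K0-WEYL-G), decreasing (`levelFamily_antitone`), and dominated by every dominant
chart point (★ «DOM-BRIDGE» `dominant_torusChart_of_levels`) — the datum of ★ `exists_cmIwahoriDatum_levels` along a ray element `a`, `E₃ a = d(α, 1, (σα)⁻¹)`, `0 < |α|_w < 1`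
(★ `cm_torus_eq_central_mul_ray_mul_ray_inv`). [cite: Casselman1995, Prop. 1.4.4 p. 14, Thm. 4.4.6 p. 45] [cite: Rogawski1990, §12.2 p. 173] -/
theorem exists_datum (hns : ∀ w' : PlacesOver L v, IsCMField.complexConj L • w'.1 = w'.1) :
    ∃ (𝓘 : (cmBorelTriple L 3 v).IwahoriDatum) (w₀ : ↥(unitaryGroupOfForm (conjLocal L (IsCMField.complexConj L) v) (cmLocalForm L 3 v))),
      (∀ n, ∀ k ∈ 𝓘.K n, k ∈ cmLocalIntegralLevel L 3 (Matrix.of fun i j : Fin 3 => if i.val + j.val + 1 = 3 then (1 : L) else 0) v) ∧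
      (∀ n, ∃ r : WithZero (Multiplicative ℤ), r < 1 ∧
        ∀ k ∈ 𝓘.K n, ∀ i j : Fin 3, Valued.v ((((k : GL (Fin 3) (LocalRing L v)).val i j - (1 : Matrix (Fin 3) (Fin 3) (LocalRing L v)) i j) : LocalRing L v) w) ≤ r) ∧
      Units.val (w₀ : GL (Fin 3) (LocalRing L v)) = cmLocalForm L 3 v ∧ (∀ n, ∀ κ ∈ 𝓘.K n, w₀ * κ * w₀⁻¹ ∈ 𝓘.K n) ∧
      Antitone (fun n => (((𝓘.K n).subgroupOf (cmBorelTriple L 3 v).M).comap (torusChartHom L v) :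
        Subgroup ((UnitaryGroup.LocalRing L v)ˣ × ↥(normOneUnits (conjLocal L (IsCMField.complexConj L) v))))) ∧
      (∀ m : ((UnitaryGroup.LocalRing L v)ˣ × ↥(normOneUnits (conjLocal L (IsCMField.complexConj L) v))), Valued.v ((m.1 : LocalRing L v) w) < 1 → ∀ n : ℕ,
        (∀ x ∈ 𝓘.K n ⊓ (cmBorelTriple L 3 v).N,
            ((torusChart L v m : ↥(cmBorelTriple L 3 v).M) : ↥(unitaryGroupOfForm (conjLocal L (IsCMField.complexConj L) v) (cmLocalForm L 3 v))) * x *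
              ((torusChart L v m : ↥(cmBorelTriple L 3 v).M) : ↥(unitaryGroupOfForm (conjLocal L (IsCMField.complexConj L) v) (cmLocalForm L 3 v)))⁻¹ ∈ 𝓘.K n) ∧
        (∀ x ∈ 𝓘.K n ⊓ 𝓘.Nbar,
            ((torusChart L v m : ↥(cmBorelTriple L 3 v).M) : ↥(unitaryGroupOfForm (conjLocal L (IsCMField.complexConj L) v) (cmLocalForm L 3 v)))⁻¹ * x *
              ((torusChart L v m : ↥(cmBorelTriple L 3 v).M) : ↥(unitaryGroupOfForm (conjLocal L (IsCMField.complexConj L) v) (cmLocalForm L 3 v))) ∈ 𝓘.K n ⊓ 𝓘.Nbar) ∧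
        (∀ x ∈ (cmBorelTriple L 3 v).N, ∃ k : ℕ, ∀ k', k ≤ k' →
            ((torusChart L v m : ↥(cmBorelTriple L 3 v).M) : ↥(unitaryGroupOfForm (conjLocal L (IsCMField.complexConj L) v) (cmLocalForm L 3 v))) ^ k' * x *
              (((torusChart L v m : ↥(cmBorelTriple L 3 v).M) : ↥(unitaryGroupOfForm (conjLocal L (IsCMField.complexConj L) v) (cmLocalForm L 3 v))) ^ k')⁻¹ ∈ 𝓘.K n)) := by
  obtain ⟨z, a₁, a₂, α₁, α₂, -, -, hα0, hα1, hE, -, -, -, -⟩ := F0P3cStCharTSShellKit.cm_torus_eq_central_mul_ray_mul_ray_inv L v w hw 1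
  obtain ⟨𝓘, K₀, -, -, -, -, hKle, hKK₀, -, -, -, -, -, hK₀, hKlev, hNbar⟩ :=
    F0P3cStCharTSDomGeneral.exists_cmIwahoriDatum_levels L v w hw a₁ hα0 hα1 hE
  obtain ⟨w₀, hw₀, -, hKw⟩ := F0P3cStCharTSK0WeylG.exists_weylElt_mem_and_forall_mul_mul_inv_mem_three L v w hw hns 𝓘 K₀ hKK₀ hK₀
  have hγ0 : valuation (w.1.adicCompletion L) α₁ ≠ 0 := (Valuation.ne_zero_iff _).2 hα0
  have hγ1 : valuation (w.1.adicCompletion L) α₁ < 1 := (v_lt_one_iff_valuation_lt_one α₁).1 hα1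
  refine ⟨𝓘, w₀, F0P3cStCharTSDomBridge.level_le_cmLocalIntegralLevel L v w hw 𝓘 K₀ hKle hK₀, fun n => ⟨Valued.v α₁ ^ (n + 1), ?_,
    valued_sub_one_le_of_levels L v w hw 𝓘 hKlev n⟩, hw₀, hKw, levelFamily_antitone L v w hw 𝓘 hα1 hKlev, fun m hm n => ?_⟩
  · exact pow_lt_one₀ zero_le hα1 (Nat.succ_ne_zero n)
  · exact F0P3cStCharTSDomBridge.dominant_torusChart_of_levels L v w hw 𝓘 hγ0 hγ1 hKlev hNbar m hm n

set_option maxHeartbeats 4000000 in  -- cross-spelling `whnf` (measured class, as §2)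
set_option synthInstance.maxHeartbeats 400000 in
/-- **«SHELLS-TT» AT THE T1 LEVELS — THE (TOR)-ROAD INTEGRATOR'S LETTER** (LH6-p01 (g3) `weylIntegration_core_of_shells`, binders `Mlev hMo hMa hMb hM0 hMr hSH` BY SHAPE).
At a non-split `v` (one place `w`) there is a family `M_n ≤ M` of open subgroups, decreasing, a neighbourhood basis of `1`, inside `M_c`, stable under `ω`, such that for
every dominant chart point `u` and every `n` some `φ ∈ C_c^∞(U(Φ₃)(L⁺_v))` supported in `Ω°_w` has `torusTransform φ = κ·(𝟙_{u M_n} + 𝟙_{u M_n} ∘ ω)`, `κ ≠ 0`, and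
`(∫ φ dν)·‖u₁‖ = 2κ·μM(u M_n)` (`δ_B^{1∕2}(ι u) = ‖u₁‖`, ★ `rootDeltaChar_cmBorel_torus`) — `M_n := ι⁻¹(M_T ∩ K_n)` for the datum of `exists_datum`.
[cite: Rogawski1990, §12.7 L. 12.7.1 (proof) p. 191; L. 12.7.2 (proof) pp. 193–194] [cite: Casselman1995, Prop. 1.4.4 p. 14, §1.5 Lemma 1.5.1] -/
theorem exists_levels_shellsTT (hns : ∀ w' : PlacesOver L v, IsCMField.complexConj L • w'.1 = w'.1) (w : PlacesOver L v)
    [MeasurableSpace (Gqs L v)] [BorelSpace (Gqs L v)]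
    [∀ γ : Gqs L v, MeasurableSpace (Gqs L v ⧸ Subgroup.centralizer ({γ} : Set (Gqs L v)))]
    [∀ γ : Gqs L v, BorelSpace (Gqs L v ⧸ Subgroup.centralizer ({γ} : Set (Gqs L v)))]
    (νQv : Measure (Gqs L v)) [νQv.IsHaarMeasure] [νQv.IsMulRightInvariant]
    {mQv : OrbitalMeasureFamily (Gqs L v)} (hcanQ : mQv.IsCanonical (fun γ => IsRegularElt (γ.val : GL (Fin 3) (UnitaryGroup.LocalRing L v))) νQv)
    [MeasurableSpace ((UnitaryGroup.LocalRing L v)ˣ × ↥(normOneUnits (conjLocal L (IsCMField.complexConj L) v)))] [BorelSpace ((UnitaryGroup.LocalRing L v)ˣ × ↥(normOneUnits (conjLocal L (IsCMField.complexConj L) v)))]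
    (μM : Measure ((UnitaryGroup.LocalRing L v)ˣ × ↥(normOneUnits (conjLocal L (IsCMField.complexConj L) v)))) [μM.IsHaarMeasure] :
    ∃ Mlev : ℕ → Subgroup ((UnitaryGroup.LocalRing L v)ˣ × ↥(normOneUnits (conjLocal L (IsCMField.complexConj L) v))),
      (∀ n, IsOpen (Mlev n : Set ((UnitaryGroup.LocalRing L v)ˣ × ↥(normOneUnits (conjLocal L (IsCMField.complexConj L) v))))) ∧ Antitone Mlev ∧
      (∀ V ∈ 𝓝 (1 : ((UnitaryGroup.LocalRing L v)ˣ × ↥(normOneUnits (conjLocal L (IsCMField.complexConj L) v)))), ∃ n, (Mlev n : Set ((UnitaryGroup.LocalRing L v)ˣ × ↥(normOneUnits (conjLocal L (IsCMField.complexConj L) v)))) ⊆ V) ∧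
      Mlev 0 ≤ (((Submonoid.pi Set.univ (fun w : PlacesOver L v => (w.1.adicCompletionIntegers L).toSubring.toSubmonoid)).units.prod (⊤ : Subgroup ↥(normOneUnits (conjLocal L (IsCMField.complexConj L) v)))) : Subgroup ((UnitaryGroup.LocalRing L v)ˣ × ↥(normOneUnits (conjLocal L (IsCMField.complexConj L) v)))) ∧
      (∀ n, ∀ m ∈ Mlev n, (fun p : ((UnitaryGroup.LocalRing L v)ˣ × ↥(normOneUnits (conjLocal L (IsCMField.complexConj L) v))) => ((Units.map ((conjLocal L (IsCMField.complexConj L) v : UnitaryGroup.LocalRing L v →+* UnitaryGroup.LocalRing L v) : UnitaryGroup.LocalRing L v →* UnitaryGroup.LocalRing L v) p.1)⁻¹, p.2)) m ∈ Mlev n) ∧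
      (∀ u : ((UnitaryGroup.LocalRing L v)ˣ × ↥(normOneUnits (conjLocal L (IsCMField.complexConj L) v))), Valued.v ((u.1 : LocalRing L v) w) < 1 → ∀ n : ℕ,
        ∃ (φ : Gqs L v → ℂ) (κ : ℂ), κ ≠ 0 ∧ IsLocSmooth φ ∧ tsupport φ ⊆ {γ : Gqs L v | 1 < Valued.v ((Pi.evalRingHom (fun w' : PlacesOver L v => w'.1.adicCompletion L) w) ((γ.val : GL (Fin 3) (UnitaryGroup.LocalRing L v)) : Matrix (Fin 3) (Fin 3) (UnitaryGroup.LocalRing L v)).trace)} ∧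
          (torusTransform L v mQv μM φ = fun m => κ * ((u • (Mlev n : Set ((UnitaryGroup.LocalRing L v)ˣ × ↥(normOneUnits (conjLocal L (IsCMField.complexConj L) v))))).indicator (fun _ => (1 : ℂ)) m + (u • (Mlev n : Set ((UnitaryGroup.LocalRing L v)ˣ × ↥(normOneUnits (conjLocal L (IsCMField.complexConj L) v))))).indicator (fun _ => (1 : ℂ)) ((fun p : ((UnitaryGroup.LocalRing L v)ˣ × ↥(normOneUnits (conjLocal L (IsCMField.complexConj L) v))) => ((Units.map ((conjLocal L (IsCMField.complexConj L) v : UnitaryGroup.LocalRing L v →+* UnitaryGroup.LocalRing L v) : UnitaryGroup.LocalRing L v →* UnitaryGroup.LocalRing L v) p.1)⁻¹, p.2)) m))) ∧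
          (∫ g, φ g ∂νQv) * (((unitModulusChar (LocalRing L v) u.1 : ℝ≥0) : ℝ) : ℂ) = 2 * κ * ((μM.real (u • (Mlev n : Set ((UnitaryGroup.LocalRing L v)ˣ × ↥(normOneUnits (conjLocal L (IsCMField.complexConj L) v))))) : ℝ) : ℂ)) := by
  have hw : IsCMField.complexConj L • w.1 = w.1 := hns w
  haveI := locallyCompactSpace_cmBorelU L 3 v
  -- the organ's σ-algebra is the only one in the statement; the matrix carrier gets its Borel σ-algebra HERE (used only through `μ_T := ι_* μM` and `ν ∘ e₁⁻¹` inside §2)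
  letI : MeasurableSpace ↥(unitaryGroupOfForm (conjLocal L (IsCMField.complexConj L) v) (cmLocalForm L 3 v)) := borel _
  haveI : BorelSpace ↥(unitaryGroupOfForm (conjLocal L (IsCMField.complexConj L) v) (cmLocalForm L 3 v)) := ⟨rfl⟩
  obtain ⟨𝓘, w₀, hKint, hKr, hw₀, hKw, hanti, hdom⟩ := exists_datum L v w hw hns
  refine ⟨fun n => ((𝓘.K n).subgroupOf (cmBorelTriple L 3 v).M).comap (torusChartHom L v),
    fun n => F0P3cStCharTSLevelFamily.isOpen_levelFamily L v 𝓘 n, hanti, fun V hV => F0P3cStCharTSLevelFamily.exists_levelFamily_subset L v 𝓘 hV,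
    F0P3cStCharTSLevelFamily.levelFamily_le_torusCompactPart L v hns 𝓘 hKint 0, fun n m hm => ?_, fun u hu n => ?_⟩
  · rw [F0P3cStCharTSLevelFamily.mem_levelFamily_iff] at hm ⊢
    rw [F0P3cStCharTSVanDijkWeylSymm.torusChart_reflect L v w₀ hw₀ m]
    exact hKw n _ hm
  · obtain ⟨r, hr, hKr'⟩ := hKr n
    obtain ⟨R, hR⟩ := F0P3cStCharTSDomGeneral.exists_isLeftTransversal_cmLevel L v 𝓘 n
      ((torusChart L v u : ↥(cmBorelTriple L 3 v).M) : ↥(unitaryGroupOfForm (conjLocal L (IsCMField.complexConj L) v) (cmLocalForm L 3 v)))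
    obtain ⟨hbN, hbNbar, hbexh⟩ := hdom u hu n
    obtain ⟨hφ, hsupp, hκ, hT, hmass⟩ := F0P3cStCharTSShellsTT.shellsTT_of_datum L v w hw hns νQv hcanQ μM 𝓘 hKint n hr hKr' w₀ hw₀ (hKw n) u hu hbN hbNbar hbexh hR
    refine ⟨_, _, hκ, hφ, hsupp, hT, ?_⟩
    rw [hmass]
    have hδ : ((rootDeltaChar (cmBorelTriple L 3 v).P (Subgroup.inclusion (cmBorelTriple L 3 v).M_le (torusChart L v u)) : ℂˣ) : ℂ) =
        (((unitModulusChar (LocalRing L v) u.1 : ℝ≥0) : ℝ) : ℂ) := by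
      have h := F0P2oBorelTorusModulus.rootDeltaChar_cmBorel_torus L v (torusChart L v u)
      rw [torusEntry_zero_torusChart] at h
      exact h
    have hne0 : unitModulusChar (LocalRing L v) u.1 ≠ 0 := by
      have h1 : unitModulusChar (LocalRing L v) u.1 * unitModulusChar (LocalRing L v) u.1⁻¹ = 1 := by rw [← map_mul, mul_inv_cancel, map_one]
      exact left_ne_zero_of_mul_eq_one h1
    have hne : (((unitModulusChar (LocalRing L v) u.1 : ℝ≥0) : ℝ) : ℂ) ≠ 0 := Complex.ofReal_ne_zero.2 (NNReal.coe_ne_zero.2 hne0)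
    rw [hδ, inv_mul_cancel_right₀ hne]

set_option maxHeartbeats 4000000 in  -- cross-spelling `whnf` (measured class, as §2)
set_option synthInstance.maxHeartbeats 400000 in
/-- **THE `hshell` BINDER OF ★ `shf_torusTransform_of_levelShells_on … Ω°_w …` AT THE T1 LEVELS, CLOSED**: for the datum of `exists_datum`, every level `n` and every
dominant `u` (`|u₁|_{w'} < 1` at every `w' ∣ v`): `∃ φ ∈ C_c^∞`, `tsupport φ ⊆ Ω°_w`, `∃ κ ≠ 0`, `torusTransform φ = κ·(𝟙_{u M_n} + 𝟙_{u M_n} ∘ ω)` — the per-`(n,u)`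
Ψ-producer instance of the (SHF′) residue. [cite: Rogawski1990, §12.7 L. 12.7.1 (proof) p. 191; L. 12.7.2 (proof) pp. 193–194] -/
theorem shf_core (hns : ∀ w' : PlacesOver L v, IsCMField.complexConj L • w'.1 = w'.1) (w : PlacesOver L v)
    [MeasurableSpace (Gqs L v)] [BorelSpace (Gqs L v)]
    [∀ γ : Gqs L v, MeasurableSpace (Gqs L v ⧸ Subgroup.centralizer ({γ} : Set (Gqs L v)))]
    [∀ γ : Gqs L v, BorelSpace (Gqs L v ⧸ Subgroup.centralizer ({γ} : Set (Gqs L v)))]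
    (νQv : Measure (Gqs L v)) [νQv.IsHaarMeasure] [νQv.IsMulRightInvariant]
    {mQv : OrbitalMeasureFamily (Gqs L v)} (hcanQ : mQv.IsCanonical (fun γ => IsRegularElt (γ.val : GL (Fin 3) (UnitaryGroup.LocalRing L v))) νQv)
    [MeasurableSpace ((UnitaryGroup.LocalRing L v)ˣ × ↥(normOneUnits (conjLocal L (IsCMField.complexConj L) v)))] [BorelSpace ((UnitaryGroup.LocalRing L v)ˣ × ↥(normOneUnits (conjLocal L (IsCMField.complexConj L) v)))]
    (μM : Measure ((UnitaryGroup.LocalRing L v)ˣ × ↥(normOneUnits (conjLocal L (IsCMField.complexConj L) v)))) [μM.IsHaarMeasure] :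
    ∀ χ : (((UnitaryGroup.LocalRing L v)ˣ →* ℂˣ) × (↥(normOneUnits (conjLocal L (IsCMField.complexConj L) v)) →* ℂˣ)), Continuous χ.1 → Continuous χ.2 → ∀ (j : Bool) (m₀ : ((UnitaryGroup.LocalRing L v)ˣ × ↥(normOneUnits (conjLocal L (IsCMField.complexConj L) v)))), m₀ ∉ ((Submonoid.pi Set.univ (fun w : PlacesOver L v => (w.1.adicCompletionIntegers L).toSubring.toSubmonoid)).units.prod (⊤ : Subgroup ↥(normOneUnits (conjLocal L (IsCMField.complexConj L) v)))) → ∃ φ : Gqs L v → ℂ, (IsLocSmooth φ ∧ tsupport φ ⊆ {γ : Gqs L v | 1 < Valued.v ((Pi.evalRingHom (fun w' : PlacesOver L v => w'.1.adicCompletion L) w) ((γ.val : GL (Fin 3) (UnitaryGroup.LocalRing L v)) : Matrix (Fin 3) (Fin 3) (UnitaryGroup.LocalRing L v)).trace)}) ∧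
        torusTransform L v mQv μM φ = fun m => ((m₀ • ((((Submonoid.pi Set.univ (fun w : PlacesOver L v => (w.1.adicCompletionIntegers L).toSubring.toSubmonoid)).units.prod (⊤ : Subgroup ↥(normOneUnits (conjLocal L (IsCMField.complexConj L) v)))) : Subgroup ((UnitaryGroup.LocalRing L v)ˣ × ↥(normOneUnits (conjLocal L (IsCMField.complexConj L) v)))) : Set ((UnitaryGroup.LocalRing L v)ˣ × ↥(normOneUnits (conjLocal L (IsCMField.complexConj L) v))))).indicator (fun m => (((pairChar L v (cond j (conjInvChar (conjLocal L (IsCMField.complexConj L) v) χ.1, χ.2) χ)) m₀ : ℂˣ) : ℂ) * ((((pairChar L v (cond j (conjInvChar (conjLocal L (IsCMField.complexConj L) v) χ.1, χ.2) χ)) m)⁻¹ : ℂˣ) : ℂ)) m) + ((m₀ • ((((Submonoid.pi Set.univ (fun w : PlacesOver L v => (w.1.adicCompletionIntegers L).toSubring.toSubmonoid)).units.prod (⊤ : Subgroup ↥(normOneUnits (conjLocal L (IsCMField.complexConj L) v)))) : Subgroup ((UnitaryGroup.LocalRing L v)ˣ × ↥(normOneUnits (conjLocal L (IsCMField.complexConj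 L) v)))) : Set ((UnitaryGroup.LocalRing L v)ˣ × ↥(normOneUnits (conjLocal L (IsCMField.complexConj L) v))))).indicator (fun m => (((pairChar L v (cond j (conjInvChar (conjLocal L (IsCMField.complexConj L) v) χ.1, χ.2) χ)) m₀ : ℂˣ) : ℂ) * ((((pairChar L v (cond j (conjInvChar (conjLocal L (IsCMField.complexConj L) v) χ.1, χ.2) χ)) m)⁻¹ : ℂˣ) : ℂ)) ((Units.map ((conjLocal L (IsCMField.complexConj L) v : UnitaryGroup.LocalRing L v →+* UnitaryGroup.LocalRing L v) : UnitaryGroup.LocalRing L v →* UnitaryGroup.LocalRing L v) m.1)⁻¹, m.2)) := by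
  have hw : IsCMField.complexConj L • w.1 = w.1 := hns w
  haveI := locallyCompactSpace_cmBorelU L 3 v
  letI : MeasurableSpace ↥(unitaryGroupOfForm (conjLocal L (IsCMField.complexConj L) v) (cmLocalForm L 3 v)) := borel _
  haveI : BorelSpace ↥(unitaryGroupOfForm (conjLocal L (IsCMField.complexConj L) v) (cmLocalForm L 3 v)) := ⟨rfl⟩
  obtain ⟨𝓘, w₀, hKint, hKr, hw₀, hKw, -, hdom⟩ := exists_datum L v w hw hns
  refine F0P3cStCharTSSurjOmega.shf_torusTransform_of_levelShells_on L v hns _ νQv hcanQ μM 𝓘 hKint fun n u hu => ?_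
  obtain ⟨r, hr, hKr'⟩ := hKr n
  obtain ⟨R, hR⟩ := F0P3cStCharTSDomGeneral.exists_isLeftTransversal_cmLevel L v 𝓘 n
    ((torusChart L v u : ↥(cmBorelTriple L 3 v).M) : ↥(unitaryGroupOfForm (conjLocal L (IsCMField.complexConj L) v) (cmLocalForm L 3 v)))
  obtain ⟨hbN, hbNbar, hbexh⟩ := hdom u (hu w) n
  obtain ⟨hφ, hsupp, hκ, hT, -⟩ := F0P3cStCharTSShellsTT.shellsTT_of_datum L v w hw hns νQv hcanQ μM 𝓘 hKint n hr hKr' w₀ hw₀ (hKw n) u (hu w) hbN hbNbar hbexh hR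
  exact ⟨_, hφ, hsupp, _, hκ, hT⟩


end Summit.HodgeConjecture.HodgeConjecture.Cruxes.H413.F0P3cStCharTSShellsTTLevels

end
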